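import Mathlib
import Summits.ABC.ABC.Statement
import Summits.ABC.ABC.Theorems.SoloBlindFermatCorner
import Summits.ABC.ABC.Theorems.SoloBlindMersenneCorner
import HarnessLib

/-!
# The two Nagell–Ljunggren residues are one-parameter families (solo-blind seat, session 5)

Sharpening `fermat_prime_corner` / `mersenne_prime_corner`: the power of two is PINNED by the base, and the residues with a linear
cofactor have `c < rad`, hence no abc content.

* `shapeC_residue_base` : `2^k p^m + 1 = q^ℓ` (`p, q, ℓ` odd primes) ⇒ `q = 2^k + 1`; so the residue is `(q^ℓ - 1)/(q - 1) = p^m`.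
* `shapeC_residue_m_one` : … and `m = 1` ⇒ `q^ℓ < 2 p q` (`c < rad`).
* `shapeD_residue_base` : `p^ℓ + 1 = 2^k q^n` (`p, q, ℓ` odd primes) ⇒ `p + 1 = 2^k`; so the residue is `(p^ℓ + 1)/(p + 1) = q^n`.
* `shapeD_residue_n_one` : … and `n = 1` ⇒ `p^ℓ + 1 < 2 p q` (`c < rad`).
* `shapeD_sq_small` : `p² + 1 = 2 q^n` with `1 ≤ n ≤ 2`, `p ≥ 2` ⇒ `2 q^n < 2 p q` (`c < rad`): the Pell branch has no abc content below `n = 3`.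
-/

namespace Summit.ABC.ABC.Theorems

/-- Parity of a geometric sum with odd ratio. -/
private theorem geom_sum_mod_two' {q : ℕ} (hq : Odd q) (n : ℕ) :
    (∑ i ∈ Finset.range n, q ^ i) % 2 = n % 2 := by
  induction n with
  | zero => simp
  | succ n ih =>
    rw [Finset.sum_range_succ, Nat.add_mod, ih]
    have : q ^ n % 2 = 1 := Nat.odd_iff.mp hq.pow
    rw [this]
    omega

/-- `2^s A = 2^k B` with `B` odd forces `s ≤ k`. -/
private theorem le_of_two_pow_mul_eq {s k A B : ℕ} (hB : B % 2 = 1) (h : 2 ^ s * A = 2 ^ k * B) : s ≤ k := by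
  by_contra hlt
  have hks : k + 1 ≤ s := by omega
  have h1 : 2 ^ k * 2 ∣ 2 ^ k * B := by
    rw [← pow_succ, ← h]
    exact (Nat.pow_dvd_pow 2 hks).mul_right A
  have h2 : 2 ∣ B := Nat.dvd_of_mul_dvd_mul_left (by positivity) h1
  omega

/-- **Shape C residue: the base pins the power of two.** `2^k p^m + 1 = q^ℓ` with `p, q, ℓ` odd primes forces `q = 2^k + 1`. -/
theorem shapeC_residue_base {k m ℓ p q : ℕ} (hp : p.Prime) (hq : q.Prime) (hℓ : ℓ.Prime) (hp2 : p ≠ 2)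
    (hq2 : q ≠ 2) (hℓ2 : ℓ ≠ 2) (h : 2 ^ k * p ^ m + 1 = q ^ ℓ) : q = 2 ^ k + 1 := by
  obtain ⟨hnot, s, hs⟩ := fermat_prime_corner hp hq hℓ hp2 hq2 hℓ2 h
  have hq3 : 3 ≤ q := by have := hq.two_le; omega
  -- `(q - 1) Φ = 2^k p^m` with `Φ` odd
  set Φ := ∑ i ∈ Finset.range ℓ, q ^ i with hΦdef
  have hgeom : Φ = (q ^ ℓ - 1) / (q - 1) := Nat.geomSum_eq (by omega) ℓ
  have hΦ : (q - 1) * Φ = 2 ^ k * p ^ m := by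
    rw [hgeom, Nat.mul_div_cancel' (Nat.sub_one_dvd_pow_sub_one q ℓ)]
    omega
  have hΦodd : Φ % 2 = 1 := by
    rw [hΦdef, geom_sum_mod_two' (hq.odd_of_ne_two hq2)]
    exact Nat.odd_iff.mp (hℓ.odd_of_ne_two hℓ2)
  have hpodd : p ^ m % 2 = 1 := Nat.odd_iff.mp (hp.odd_of_ne_two hp2).pow
  have hq1 : q - 1 = 2 ^ s := by omega
  rw [hq1] at hΦ
  have h1 : s ≤ k := le_of_two_pow_mul_eq hpodd hΦ
  have h2 : k ≤ s := le_of_two_pow_mul_eq hΦodd hΦ.symm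
  have : s = k := le_antisymm h1 h2
  subst this
  omega

/-- … and with a linear cofactor (`m = 1`) the triple has `c < rad`: `q^ℓ < 2 p q`. -/
theorem shapeC_residue_m_one {k ℓ p q : ℕ} (hp : p.Prime) (hq : q.Prime) (hℓ : ℓ.Prime) (hp2 : p ≠ 2)
    (hq2 : q ≠ 2) (hℓ2 : ℓ ≠ 2) (h : 2 ^ k * p ^ 1 + 1 = q ^ ℓ) : q ^ ℓ < 2 * p * q := by
  have hb := shapeC_residue_base hp hq hℓ hp2 hq2 hℓ2 h
  rw [pow_one] at h
  have hp1 : 1 ≤ p := hp.one_le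
  have : 2 ^ k = q - 1 := by rw [hb, Nat.add_sub_cancel]
  rw [← h, this]
  have hq1 : 1 ≤ q := hq.one_le
  zify [hq1]
  nlinarith

/-- **Shape D residue: the base pins the power of two.** `p^ℓ + 1 = 2^k q^n` with `p, q, ℓ` odd primes forces `p + 1 = 2^k`. -/
theorem shapeD_residue_base {k n ℓ p q : ℕ} (hp : p.Prime) (hq : q.Prime) (hℓ : ℓ.Prime) (hp2 : p ≠ 2)
    (hq2 : q ≠ 2) (hℓ2 : ℓ ≠ 2) (h : p ^ ℓ + 1 = 2 ^ k * q ^ n) : p + 1 = 2 ^ k := by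
  obtain ⟨hnot, s, hs⟩ := mersenne_prime_corner hp hq hℓ hp2 hq2 hℓ2 h
  have hp3 : 3 ≤ p := by have := hp.two_le; omega
  obtain ⟨h', hℓh⟩ : ∃ h', ℓ = 2 * h' + 1 := hℓ.odd_of_ne_two hℓ2
  -- `Ψ = (p-1) p S + 1` with `(p+1) Ψ = p^ℓ + 1`, `Ψ` odd
  set S := ∑ i ∈ Finset.range h', (p ^ 2) ^ i with hSdef
  have hp2le : 2 ≤ p ^ 2 := by nlinarith
  have hgeom : S = ((p ^ 2) ^ h' - 1) / (p ^ 2 - 1) := Nat.geomSum_eq hp2le h'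
  have hS : (p ^ 2 - 1) * S = (p ^ 2) ^ h' - 1 := by
    rw [hgeom, Nat.mul_div_cancel' (Nat.sub_one_dvd_pow_sub_one (p ^ 2) h')]
  set Ψ := (p - 1) * p * S + 1 with hΨdef
  have hΨ : (p + 1) * Ψ = 2 ^ k * q ^ n := by
    rw [← h, hℓh, hΨdef]
    have h1 : 1 ≤ (p ^ 2) ^ h' := Nat.one_le_pow _ _ (by positivity)
    have h2 : 1 ≤ p ^ 2 := by omega
    have h3 : 1 ≤ p := by omega
    zify [h1, h2, h3] at hS ⊢
    linear_combination (p : ℤ) * hS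
  have hΨodd : Ψ % 2 = 1 := by
    have h2 : 2 ∣ (p - 1) * p * S := by
      have : 2 ∣ p - 1 := by
        have := Nat.odd_iff.mp (hp.odd_of_ne_two hp2)
        omega
      exact (this.mul_right p).mul_right S
    omega
  have hqodd : q ^ n % 2 = 1 := Nat.odd_iff.mp (hq.odd_of_ne_two hq2).pow
  rw [hs] at hΨ
  have h1 : s ≤ k := le_of_two_pow_mul_eq hqodd hΨ
  have h2 : k ≤ s := le_of_two_pow_mul_eq hΨodd hΨ.symm
  have : s = k := le_antisymm h1 h2
  subst this
  exact hs

/-- … and with a linear cofactor (`n = 1`) the triple has `c < rad`: `p^ℓ + 1 < 2 p q`. -/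
theorem shapeD_residue_n_one {k ℓ p q : ℕ} (hp : p.Prime) (hq : q.Prime) (hℓ : ℓ.Prime) (hp2 : p ≠ 2)
    (hq2 : q ≠ 2) (hℓ2 : ℓ ≠ 2) (h : p ^ ℓ + 1 = 2 ^ k * q ^ 1) : p ^ ℓ + 1 < 2 * p * q := by
  have hb := shapeD_residue_base hp hq hℓ hp2 hq2 hℓ2 h
  rw [pow_one, ← hb] at h
  rw [h]
  have hp2' : 2 ≤ p := hp.two_le
  have hq1 : 1 ≤ q := hq.one_le
  nlinarith

/-- **The Pell branch of shape D is abc-irrelevant below `n = 3`.** `p² + 1 = 2 q^n`, `p ≥ 2`, `1 ≤ n ≤ 2` ⇒ `2 q^n < 2 p q`. -/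
theorem shapeD_sq_small {n p q : ℕ} (hp : 2 ≤ p) (hq : 1 ≤ q) (hn1 : 1 ≤ n) (hn2 : n ≤ 2)
    (h : p ^ 2 + 1 = 2 * q ^ n) : 2 * q ^ n < 2 * p * q := by
  interval_cases n
  · rw [pow_one] at h ⊢
    nlinarith
  · have hqp : q < p := by nlinarith
    nlinarith

end Summit.ABC.ABC.Theorems
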